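import Summits.ValiantsHypothesis.ValiantsHypothesis.Theorems.GrenetZeonDualUnipotentThreeHalvesHeavyTopShiftSandwich

/-!
# `GrenetZeon.DualUnipotentThreeHalves` (stmt-ValiantsHypothesis-24318) — P-Q1 kernel port (lead-g2 `P-Q1-LEVEL2-PORTMAP.md` L2.3):
# THE (E1) IDENTITY, EVALUATED: `Σ_{a+b=k−2} tr(ŵ_j A^a Ê A^b) = τ_j(k−1, 0) + g_{j+k−2}`

Experiment cell «val-heavytop-census» (D-0160), engine seat val-htc-eng-1 (g3), kit 0; director R340 (3) (P-Q1 port, eng lineage).  Conventions of the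
bricks (`Fin (s+1)`, `ω = Fin.last s`, shift `A` via `hA`); letters as in the port map (B): `ŵ_j = E_{ωj} + τ_j + γ_j`, `Ê = E_{01} + γ`, matrix units
`E_{pq} = vecMulVec (Pi.single p 1) (Pi.single q 1)`.

* tools: `unit_apply`, `mul_apply_of_row_eq_zero`, `mul_apply_of_col_eq_zero`, `trace_mul_eq_sum_sum`; `sandwich_row_last_eq_zero` /
  `sandwich_col_last_eq_zero` (row / column `ω` of `A^a F A^b`).
* ★★ `E1_identity` — for `2 ≤ k ≤ s`, a block row `j < s`, `τ` off the border row/column, `γ_j` and `γ` supported in column `ω`, `γ_{ωω} = 0`: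
  `Σ_{a<k−1} tr((E_{ωj} + τ + γ_j) · A^a · (E_{01} + γ) · A^{k−2−a}) = τ_{k−1,0} + γ_{j+k−2, ω}` (the last term is `0` once `j + k − 2 > s`, and equals
  `g_{j+k−2}` under the support of `γ`).  Of the six letter pairs only `(τ, E_{01})` at `a = 0` and `(E_{ωj}, γ)` at `b = 0` survive — the other four
  vanish identically (port map §A: no weight separation needed), each by one line of ✓ `…HeavyTopShiftSandwich`.
  With ✓ `…HeavyTopTraceFirstOrder.sum_trace_mul_sandwich_eq_zero_of_mem` (the same sum is `0` in a nilpotent space containing `ŵ_j, A, Ê`):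
  **`τ_j(k−1, 0) + g_{j+k−2} = 0`**, i.e. (E1) of Q1-PROOF §2 in the kernel, for every `s`.  (The lower-triangularity of `τ_j` is not used here; it
  enters only (E2).)

Pure matrix algebra; ι(7), (5,7), R2, 24318 OPEN / not moved; VP ≠ VNP NOT proved.  `--supports stmt-ValiantsHypothesis-24318 --as helper`.
No definitions, no named facts. [lead-g2 Q1-PROOF §2 (E1); `P-Q1-LEVEL2-PORTMAP.md` (A), (B), (C) L2.3; this seat]
-/

set_option linter.dupNamespace false
set_option autoImplicit false

namespace Summit.ValiantsHypothesis.ValiantsHypothesis.Theorems.GrenetZeon.HeavyTopE1Identity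

open Matrix
open scoped BigOperators
open Summit.ValiantsHypothesis.ValiantsHypothesis.Theorems.GrenetZeon.HeavyTopBorderShift (shift_pow_succ_apply)
open Summit.ValiantsHypothesis.ValiantsHypothesis.Theorems.GrenetZeon.HeavyTopShiftSandwich

variable {s : ℕ}

/-! ## §1 Small tools: matrix units, zero border rows/columns through products -/

/-- Entries of a matrix unit `E_{pq} = e_p e_qᵀ`. -/
theorem unit_apply {n : Type*} [DecidableEq n] (p q i j : n) :
    vecMulVec (Pi.single p (1 : ℂ)) (Pi.single q (1 : ℂ)) i j = if i = p ∧ j = q then 1 else 0 := by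
  simp only [vecMulVec_apply, Pi.single_apply]
  split_ifs <;> simp_all

/-- A zero row survives right multiplication. -/
theorem mul_apply_of_row_eq_zero {n : Type*} [Fintype n] (M N : Matrix n n ℂ) (i : n) (h : ∀ l, M i l = 0) (j : n) :
    (M * N) i j = 0 := by
  rw [Matrix.mul_apply]
  exact Finset.sum_eq_zero fun l _ => by rw [h l, zero_mul]

/-- A zero column survives left multiplication. -/
theorem mul_apply_of_col_eq_zero {n : Type*} [Fintype n] (M N : Matrix n n ℂ) (j : n) (h : ∀ l, N l j = 0) (i : n) :
    (M * N) i j = 0 := by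
  rw [Matrix.mul_apply]
  exact Finset.sum_eq_zero fun l _ => by rw [h l, mul_zero]

/-- `tr(τ N) = Σ_p Σ_q τ_{pq} N_{qp}`. -/
theorem trace_mul_eq_sum_sum {n : Type*} [Fintype n] (τ N : Matrix n n ℂ) :
    Matrix.trace (τ * N) = ∑ p, ∑ q, τ p q * N q p := by
  simp only [Matrix.trace, Matrix.diag_apply, Matrix.mul_apply]

/-! ## §2 The six letter pairs of (E1) -/

section Pairs

/-- Row `ω` of `A^a E A^b` vanishes for `a ≥ 1`, and for `a = 0` when `E` has zero row `ω`. -/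
theorem sandwich_row_last_eq_zero (A : Matrix (Fin (s + 1)) (Fin (s + 1)) ℂ)
    (hA : ∀ i j : Fin (s + 1), A i j = if (j : ℕ) = i + 1 ∧ (j : ℕ) < s then 1 else 0)
    (E : Matrix (Fin (s + 1)) (Fin (s + 1)) ℂ) (hE : ∀ l, E (Fin.last s) l = 0) (a b : ℕ)
    (p : Fin (s + 1)) : (A ^ a * E * A ^ b) (Fin.last s) p = 0 := by
  apply mul_apply_of_row_eq_zero
  intro l
  rcases Nat.eq_zero_or_pos a with rfl | ha
  · rw [pow_zero, Matrix.one_mul, hE]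
  · obtain ⟨a', rfl⟩ : ∃ a', a = a' + 1 := ⟨a - 1, by omega⟩
    exact shift_pow_succ_mul_apply_last A hA E a' l

/-- Column `ω` of `A^a E A^b` vanishes for `b ≥ 1`, and for `b = 0` when `E` has zero column `ω`. -/
theorem sandwich_col_last_eq_zero (A : Matrix (Fin (s + 1)) (Fin (s + 1)) ℂ)
    (hA : ∀ i j : Fin (s + 1), A i j = if (j : ℕ) = i + 1 ∧ (j : ℕ) < s then 1 else 0)
    (E : Matrix (Fin (s + 1)) (Fin (s + 1)) ℂ) (hE : ∀ l, E l (Fin.last s) = 0) (a b : ℕ)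
    (i : Fin (s + 1)) : (A ^ a * E * A ^ b) i (Fin.last s) = 0 := by
  rcases Nat.eq_zero_or_pos b with rfl | hb
  · rw [pow_zero, Matrix.mul_one]
    exact mul_apply_of_col_eq_zero _ _ _ hE i
  · obtain ⟨b', rfl⟩ : ∃ b', b = b' + 1 := ⟨b - 1, by omega⟩
    exact mul_shift_pow_succ_apply_last A hA (A ^ a * E) b' i

end Pairs

/-! ## §3 The (E1) identity -/

/-- ★★ **(E1), evaluated** (port map L2.3).  Letters: `ŵ = E_{ωj} + τ + γⱼ` with `τ` off the border (`τ_{ω·} = τ_{·ω} = 0`) and `γⱼ` in column `ω`;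
`Ê = E_{01} + γ` with `γ` in column `ω`, `γ_{ωω} = 0`.  Then for `2 ≤ k ≤ s` and a block row `j < s`:
`Σ_{a<k−1} tr(ŵ · A^a · Ê · A^{k−2−a}) = τ_{k−1,0} + γ_{j+k−2,ω}` (the last term read as `0` when `j + k − 2 ≥ s + 1`; by the support of `γ` it is `g_{j+k−2}`).
Only the pairs `(τ, E_{01})` (at `a = 0`) and `(E_{ωj}, γ)` (at `b = 0`) contribute; the four others vanish identically (port map §A).
Combined with ✓ `sum_trace_mul_sandwich_eq_zero_of_mem` (the left side is `0` in a nilpotent space containing `ŵ, A, Ê`): `τ_{k−1,0} + g_{j+k−2} = 0`.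
[lead-g2 Q1-PROOF §2 (E1); port map (B); this file] -/
theorem E1_identity (hs : 2 ≤ s) (A : Matrix (Fin (s + 1)) (Fin (s + 1)) ℂ)
    (hA : ∀ i j : Fin (s + 1), A i j = if (j : ℕ) = i + 1 ∧ (j : ℕ) < s then 1 else 0)
    (j : Fin (s + 1)) (hj : (j : ℕ) < s) (τ γj γ : Matrix (Fin (s + 1)) (Fin (s + 1)) ℂ)
    (hτrow : ∀ q, τ (Fin.last s) q = 0) (hτcol : ∀ p, τ p (Fin.last s) = 0)
    (hγj : ∀ p q, q ≠ Fin.last s → γj p q = 0) (hγ : ∀ p q, q ≠ Fin.last s → γ p q = 0) (hγω : γ (Fin.last s) (Fin.last s) = 0)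
    (k : ℕ) (hk : 2 ≤ k) (hks : k ≤ s) :
    ∑ a ∈ Finset.range (k - 1), Matrix.trace
        ((vecMulVec (Pi.single (Fin.last s) (1 : ℂ)) (Pi.single j (1 : ℂ)) + τ + γj) *
          (A ^ a * (vecMulVec (Pi.single (0 : Fin (s + 1)) (1 : ℂ)) (Pi.single (⟨1, by omega⟩ : Fin (s + 1)) (1 : ℂ)) + γ) *
            A ^ (k - 1 - 1 - a))) =
      τ ⟨k - 1, by omega⟩ 0 + (if h : (j : ℕ) + (k - 2) < s + 1 then γ ⟨(j : ℕ) + (k - 2), h⟩ (Fin.last s) else 0) := by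
  classical
  set ω : Fin (s + 1) := Fin.last s with hω
  set U := vecMulVec (Pi.single ω (1 : ℂ)) (Pi.single j (1 : ℂ)) with hU
  set E := vecMulVec (Pi.single (0 : Fin (s + 1)) (1 : ℂ)) (Pi.single (⟨1, by omega⟩ : Fin (s + 1)) (1 : ℂ)) with hE
  have hωval : (ω : ℕ) = s := rfl
  have hω0 : ω ≠ 0 := fun h => by have := congrArg Fin.val h; simp [hωval] at this; omega
  have hω1 : ω ≠ ⟨1, by omega⟩ := fun h => by have := congrArg Fin.val h; rw [hωval] at this; simp at this; omega
  have hErow : ∀ l, E ω l = 0 := fun l => by rw [hE, unit_apply, if_neg (fun h => hω0 h.1)]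
  have hEcol : ∀ l, E l ω = 0 := fun l => by rw [hE, unit_apply, if_neg (fun h => hω1 h.2)]
  have hγrow : ∀ l, γ ω l = 0 := fun l => by
    by_cases hl : l = ω
    · rw [hl]; exact hγω
    · exact hγ ω l hl
  -- per-`a` evaluation of the six pairs
  have hterm : ∀ (a b : ℕ) (hab : a + b = k - 2),
      Matrix.trace ((U + τ + γj) * (A ^ a * (E + γ) * A ^ b)) =
        (if a = 0 then τ ⟨b + 1, by omega⟩ 0 else 0) +
          (if b = 0 then (if h : (j : ℕ) + a < s + 1 then γ ⟨(j : ℕ) + a, h⟩ ω else 0) else 0) := by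
    intro a b hab
    -- (1) `(E_{ωj}, E_{01})`
    have t1 : Matrix.trace (U * (A ^ a * E * A ^ b)) = 0 := by
      rw [hU, HeavyTopShiftSandwich.trace_single_mul]
      exact sandwich_col_last_eq_zero A hA E hEcol a b j
    -- (2) `(E_{ωj}, γ)`
    have t2 : Matrix.trace (U * (A ^ a * γ * A ^ b)) =
        if b = 0 then (if h : (j : ℕ) + a < s + 1 then γ ⟨(j : ℕ) + a, h⟩ ω else 0) else 0 := by
      rw [hU, HeavyTopShiftSandwich.trace_single_mul]
      rcases Nat.eq_zero_or_pos b with rfl | hb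
      · rw [if_pos rfl, pow_zero, Matrix.mul_one, shift_pow_mul_apply A hA γ a j ω hj]
        by_cases h : (j : ℕ) + a < s
        · rw [dif_pos h, dif_pos (by omega)]
        · rw [dif_neg h]
          by_cases h' : (j : ℕ) + a < s + 1
          · rw [dif_pos h']
            have : (⟨(j : ℕ) + a, h'⟩ : Fin (s + 1)) = ω := Fin.ext (by simp only [hωval]; omega)
            rw [this, hγω]
          · rw [dif_neg h']
      · obtain ⟨b', rfl⟩ : ∃ b', b = b' + 1 := ⟨b - 1, by omega⟩
        rw [if_neg (by omega)]
        exact mul_shift_pow_succ_apply_last A hA (A ^ a * γ) b' j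
    -- (3) `(τ, E_{01})`
    have t3 : Matrix.trace (τ * (A ^ a * E * A ^ b)) = if a = 0 then τ ⟨b + 1, by omega⟩ 0 else 0 := by
      rw [trace_mul_eq_sum_sum]
      -- entries of the sandwich at block positions
      have hN : ∀ q p : Fin (s + 1), (q : ℕ) < s → (p : ℕ) < s →
          (A ^ a * E * A ^ b) q p = if a = 0 ∧ (q : ℕ) = 0 ∧ (p : ℕ) = b + 1 then 1 else 0 := by
        intro q p hq hp
        rw [shift_sandwich_apply A hA E a b q p hq hp]
        by_cases h : (q : ℕ) + a < s ∧ b ≤ (p : ℕ)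
        · rw [dif_pos h, hE, unit_apply]
          simp only [Fin.ext_iff, Fin.val_zero]
          by_cases h2 : a = 0 ∧ (q : ℕ) = 0 ∧ (p : ℕ) = b + 1
          · rw [if_pos h2, if_pos (by omega)]
          · rw [if_neg h2, if_neg (by omega)]
        · rw [dif_neg h, if_neg (by omega)]
      by_cases ha : a = 0
      · rw [if_pos ha, Finset.sum_eq_single ⟨b + 1, by omega⟩]
        · rw [Finset.sum_eq_single 0]
          · rw [hN 0 _ (by simp; omega) (by simp; omega), if_pos ⟨ha, rfl, rfl⟩, mul_one]
          · intro q _ hq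
            by_cases hqω : q = ω
            · rw [hqω, hτcol, zero_mul]
            · have hq' : (q : ℕ) < s := by
                have := q.isLt
                have : (q : ℕ) ≠ s := fun e => hqω (Fin.ext (by rw [hωval]; exact e))
                omega
              have hq0 : (q : ℕ) ≠ 0 := fun e => hq (Fin.ext e)
              rw [hN q _ hq' (by simp; omega), if_neg (by omega), mul_zero]
          · intro h'
            exact absurd (Finset.mem_univ _) h'
        · intro p _ hp
          by_cases hpω : p = ω
          · rw [hpω]
            exact Finset.sum_eq_zero fun q _ => by rw [hτrow, zero_mul]
          · have hp' : (p : ℕ) < s := by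
              have := p.isLt
              have : (p : ℕ) ≠ s := fun e => hpω (Fin.ext (by rw [hωval]; exact e))
              omega
            have hpb : (p : ℕ) ≠ b + 1 := fun e => hp (Fin.ext e)
            refine Finset.sum_eq_zero fun q _ => ?_
            by_cases hqω : q = ω
            · rw [hqω, hτcol, zero_mul]
            · have hq' : (q : ℕ) < s := by
                have := q.isLt
                have : (q : ℕ) ≠ s := fun e => hqω (Fin.ext (by rw [hωval]; exact e))
                omega
              rw [hN q p hq' hp', if_neg (by omega), mul_zero]
        · intro h'
          exact absurd (Finset.mem_univ _) h'
      · rw [if_neg ha]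
        refine Finset.sum_eq_zero fun p _ => Finset.sum_eq_zero fun q _ => ?_
        by_cases hpω : p = ω
        · rw [hpω, hτrow, zero_mul]
        · by_cases hqω : q = ω
          · rw [hqω, hτcol, zero_mul]
          · have hp' : (p : ℕ) < s := by
              have := p.isLt
              have : (p : ℕ) ≠ s := fun e => hpω (Fin.ext (by rw [hωval]; exact e))
              omega
            have hq' : (q : ℕ) < s := by
              have := q.isLt
              have : (q : ℕ) ≠ s := fun e => hqω (Fin.ext (by rw [hωval]; exact e))
              omega
            rw [hN q p hq' hp', if_neg (by omega), mul_zero]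
    -- (4) `(τ, γ)`
    have t4 : Matrix.trace (τ * (A ^ a * γ * A ^ b)) = 0 := by
      rw [trace_mul_eq_sum_sum]
      refine Finset.sum_eq_zero fun p _ => Finset.sum_eq_zero fun q _ => ?_
      by_cases hpω : p = ω
      · rw [hpω, hτrow, zero_mul]
      · by_cases hqω : q = ω
        · rw [hqω, hτcol, zero_mul]
        · have hp' : (p : ℕ) < s := by
            have := p.isLt
            have : (p : ℕ) ≠ s := fun e => hpω (Fin.ext (by rw [hωval]; exact e))
            omega
          have hq' : (q : ℕ) < s := by
            have := q.isLt
            have : (q : ℕ) ≠ s := fun e => hqω (Fin.ext (by rw [hωval]; exact e))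
            omega
          rw [shift_sandwich_apply A hA γ a b q p hq' hp']
          by_cases h : (q : ℕ) + a < s ∧ b ≤ (p : ℕ)
          · rw [dif_pos h, hγ _ _ (fun e => by have := congrArg Fin.val e; rw [hωval] at this; simp at this; omega), mul_zero]
          · rw [dif_neg h, mul_zero]
    -- (5) `(γⱼ, E_{01})` and (6) `(γⱼ, γ)`: `γⱼ` sees only row `ω` of the sandwich, which vanishes
    have t56 : ∀ F : Matrix (Fin (s + 1)) (Fin (s + 1)) ℂ, (∀ l, F ω l = 0) → Matrix.trace (γj * (A ^ a * F * A ^ b)) = 0 := by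
      intro F hF
      rw [trace_mul_eq_sum_sum]
      refine Finset.sum_eq_zero fun p _ => Finset.sum_eq_zero fun q _ => ?_
      by_cases hqω : q = ω
      · rw [hqω, sandwich_row_last_eq_zero A hA F hF a b p, mul_zero]
      · rw [hγj p q hqω, zero_mul]
    have t5 := t56 E hErow
    have t6 := t56 γ hγrow
    -- assemble the six pairs
    have expand : (U + τ + γj) * (A ^ a * (E + γ) * A ^ b) =
        U * (A ^ a * E * A ^ b) + U * (A ^ a * γ * A ^ b) + (τ * (A ^ a * E * A ^ b) + τ * (A ^ a * γ * A ^ b)) +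
          (γj * (A ^ a * E * A ^ b) + γj * (A ^ a * γ * A ^ b)) := by
      simp only [Matrix.mul_add, Matrix.add_mul]
      abel
    rw [expand, Matrix.trace_add, Matrix.trace_add, Matrix.trace_add, Matrix.trace_add, Matrix.trace_add, t1, t2, t3, t4, t5, t6]
    ring
  -- sum over `a`
  have hsum : ∀ a ∈ Finset.range (k - 1), Matrix.trace ((U + τ + γj) * (A ^ a * (E + γ) * A ^ (k - 1 - 1 - a))) =
      (if a = 0 then τ ⟨k - 1, by omega⟩ 0 else 0) +
        (if a = k - 2 then (if h : (j : ℕ) + (k - 2) < s + 1 then γ ⟨(j : ℕ) + (k - 2), h⟩ ω else 0) else 0) := by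
    intro a ha
    have ha' := Finset.mem_range.1 ha
    rw [hterm a (k - 1 - 1 - a) (by omega)]
    congr 1
    · by_cases h0 : a = 0
      · have hidx : (⟨k - 1 - 1 - a + 1, by omega⟩ : Fin (s + 1)) = ⟨k - 1, by omega⟩ := Fin.ext (by simp only; omega)
        rw [if_pos h0, if_pos h0, hidx]
      · rw [if_neg h0, if_neg h0]
    · by_cases h2 : a = k - 2
      · subst h2
        rw [if_pos (by omega), if_pos rfl]
      · rw [if_neg (by omega), if_neg h2]
  rw [Finset.sum_congr rfl hsum, Finset.sum_add_distrib, Finset.sum_ite_eq', Finset.sum_ite_eq', if_pos (Finset.mem_range.2 (by omega)),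
    if_pos (Finset.mem_range.2 (by omega))]

end Summit.ValiantsHypothesis.ValiantsHypothesis.Theorems.GrenetZeon.HeavyTopE1Identity
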